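import Mathlib
import HarnessLib
import Summits.CriticalPhenomena.SAWScalingLimit.Theses.SAWLeftRightFKG
import Literature.Probability.LatticeModels.DirichletGreenFunction

/-!
# Sketch — first lemmas for crux ideas on `FKGToTraversalBound` (stmt-CriticalPhenomena-1878)

Folder-local sketch (crux-ideate round 1, ideator 3). Everything is a `Prop`; nothing is proved.

* `Sandwich`, `SandwichOfFKG` — card `carve-fill-sandwich`: the one inequality behind both
  one-sided comparison moves (remove left-attached sites / add right-attached sites), provable now
  from `LeftRightFKG` by inclusion–exclusion.
* `DoorSquare` — the canonical residue ("door lemma" in box form) that the sandwich + private rooms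
  leave over: attaching the lower half-box multiplies the top-corner-to-top-corner critical
  partition function by at most a constant, uniformly in the size.
* `UniformTraversalTightness`, `QuantileReduction` — card `free-loop-rerouting`: the crux's
  conclusion needs NO rate, only uniform tightness of the traversal counts (pure logic, provable now).
* `FreeLoop` — card `free-loop-rerouting`: two routes tip → target enclose only domain (plane topology).
* `Avoid`, `ExcursionDomination` — card `excursion-domination`: the critical chord avoids a
  one-sided set of sites at least as well as a fixed power of the random-walk excursion
  (Dirichlet Green function ratio).
-/

namespace Summit.CriticalPhenomena.SAWScalingLimit.Cruxes.FKGToTraversalBound.Sketch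

open scoped BigOperators ENNReal
open MeasureTheory Literature.Probability.LatticeModels
open Literature.Probability.RandomPlanarGeometry
open Summit.CriticalPhenomena.SAWScalingLimit.Theses.SAWLeftRightFKG

noncomputable section

/-- **Sandwich inequality** (first lemma of card `carve-fill-sandwich`; provable now from
`LeftRightFKG`). In the route's own typing of the lattice domain `Ω` enclosed by a closed walk `C`
and of the left–right order `le`, a `le`-DOWN-closed event `D` and a `le`-UP-closed event `U` are
negatively correlated: `w(D ∩ U) · w(univ) ≤ w(D) · w(U)`. With `U = {γ avoids a left-attached set
of sites}` (so that `w(· ∩ U)` is the weight of the carved domain) this is the carving move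
`P_{Ω∖H_L}(D) ≤ P_Ω(D)`; read in a bigger domain `Ω⁺ ⊇ Ω` with `D = {avoid a right hull}` and
`Ω = Ω⁺ ∖ F`, `F` right-attached, positive correlation of the two down-events gives the filling
move `P_Ω(avoid H) ≥ P_{Ω⁺}(avoid H⁺)`. -/
def Sandwich : Prop :=
  ∀ (δ : ℝ) (c a b a' b' : Site 2) (C : (zdGraph 2).Walk c c), let Ω : Set ℂ := {z | Literature.Topology.PlaneTopology.wind (fun t : ℝ => Set.IccExtend zero_le_one (C.toCurve (meshPoint δ)) t - z) ≠ 0}; let le : SAW.DomainSAW Ω δ a b → SAW.DomainSAW Ω δ a b → Prop := fun γ₁ γ₂ => ∀ z : ℂ, 0 ≤ Literature.Topology.PlaneTopology.wind (fun t : ℝ => Set.IccExtend zero_le_one ((γ₁.walk.append γ₂.walk.reverse).toCurve (meshPoint δ)) t - z); 0 < δ → a' ∈ C.support → b' ∈ C.support → (zdGraph 2).Adj a a' → (zdGraph 2).Adj b b' → ∀ D U : Set (SAW.DomainSAW Ω δ a b), (∀ γ₁ γ₂, le γ₁ γ₂ → γ₂ ∈ D → γ₁ ∈ D) → (∀ γ₁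 γ₂, le γ₁ γ₂ → γ₁ ∈ U → γ₂ ∈ U) → SAW.weight Ω δ a b (D ∩ U) * SAW.weight Ω δ a b Set.univ ≤ SAW.weight Ω δ a b D * SAW.weight Ω δ a b U

/-- The sandwich inequality follows from the route's hypothesis (inclusion–exclusion on finite
weights; the only analysis is `weight univ < ∞` for bounded `Ω`). -/
def SandwichOfFKG : Prop := LeftRightFKG → Sandwich

/-- The open lattice box `(x₁, x₂) × (y₁, y₂) ⊂ ℂ`. -/
def boxC (x₁ x₂ y₁ y₂ : ℝ) : Set ℂ := {z | x₁ < z.re ∧ z.re < x₂ ∧ y₁ < z.im ∧ z.im < y₂}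

/-- **Door lemma, box form** (canonical residue of card `carve-fill-sandwich`; conjecture, RSW-type).
At mesh `1` the open box `(-n, n) × (-n, n)` has site rows `-n+1 … n-1`; its "upper room" is the box
`(-n, n) × (0, n)` (rows `1 … n-1`), the two marked points are the upper room's top corners
`(∓(n-1), n-1)`. Claim: attaching the lower room through the full-width door multiplies the critical
corner-to-corner partition function by at most `C`, uniformly in `n`; equivalently the chord of the
big box between its two top corners stays in the upper room with probability `≥ 1/C`. -/
def DoorSquare : Prop :=
  ∃ C : ℝ, 0 < C ∧ ∀ n : ℕ, 2 ≤ n →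
    SAW.weight (boxC (-(n : ℝ)) n (-(n : ℝ)) n) 1 ![-(n : ℤ) + 1, (n : ℤ) - 1] ![(n : ℤ) - 1, (n : ℤ) - 1] Set.univ
      ≤ ENNReal.ofReal C *
        SAW.weight (boxC (-(n : ℝ)) n 0 n) 1 ![-(n : ℤ) + 1, (n : ℤ) - 1] ![(n : ℤ) - 1, (n : ℤ) - 1] Set.univ

/-- **Uniform tightness of traversal counts** (card `free-loop-rerouting`): for every Dobrushin
domain and endpoint approximation there is `δ₀ > 0` such that for every `ε > 0` ONE threshold `n`
makes `n` separate traversals of EVERY 2-shell `D(x; ρ, R)`, `δ ≤ ρ`, `2ρ ≤ R ≤ 1`, have probability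
`≤ ε` at EVERY mesh `δ ≤ δ₀`. No rate in `ρ/R` is asked. -/
def UniformTraversalTightness : Prop :=
  ∀ (D : DobrushinDomain) (a b : ℝ → Site 2), SAW.IsEndpointApprox D a b →
    ∃ δ₀ : ℝ, 0 < δ₀ ∧ ∀ ε : ℝ, 0 < ε → ∃ n : ℕ, ∀ δ ∈ Set.Ioc (0 : ℝ) δ₀, ∀ (x : ℂ) (ρ R : ℝ),
      δ ≤ ρ → 2 * ρ ≤ R → R ≤ 1 →
        SAW.law D.carrier δ (a δ) (b δ)
            {γ | (⟨γ.walk.toCurve (meshPoint δ)⟩ : Curve ℂ).HasTraversals n x ρ R}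
          ≤ ENNReal.ofReal ε

/-- **Quantile reduction** (card `free-loop-rerouting`; provable now, pure logic):
uniform tightness of the traversal counts already gives the Aizenman–Burchard hypothesis of the
route with `λ = 3`, `K = 8` and the shell-dependent threshold `k(x, ρ, R) :=` the `(ρ/R)³`-quantile
(and `k := 0` with the trivial bound when `R < 2ρ`, where `8 (ρ/R)³ > 1 ≥ law(…)`). -/
def QuantileReduction : Prop := UniformTraversalTightness → SAWTraversalBound

/-- **Free-loop lemma, lattice form** (first lemma of card `free-loop-rerouting`; plane topology,
provable): in a lattice domain of the route's typing `Ω = {wind(C,·) ≠ 0}` (this covers `D_δ ∖ past`: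
the closed boundary walk `C` runs out and back along the past), if two self-avoiding lattice routes
`R₁, R₂ : a → b` of `Ω_δ` meet only at their endpoints, then every point enclosed by the loop
`R₁ · R₂⁻¹` (nonzero winding number of its mesh polyline) lies in `Ω`: the region between two routes is
FREE of boundary — no wall, and in particular no piece of the past, can sit inside. (The trace of `C` is
connected, misses the loop, and is not surrounded by it.) -/
def FreeLoop : Prop :=
  ∀ (δ : ℝ) (c a b : Site 2) (C : (zdGraph 2).Walk c c), let Ω : Set ℂ := {z | Literature.Topology.PlaneTopology.wind (fun t : ℝ => Set.IccExtend zero_le_one (C.toCurve (meshPoint δ)) t - z) ≠ 0}; 0 < δ → ∀ (R₁ R₂ : (discreteDomainGraph Ω δ).Walk a b), R₁.IsPath → R₂.IsPath → (∀ v ∈ R₁.support, v ∈ R₂.support → v = a ∨ v = b) → ∀ z : ℂ, Literature.Topology.PlaneTopology.wind (fun t : ℝ => Set.IccExtend zero_le_one ((R₁.append R₂.reverse).toCurve (meshPoint δ)) t - z) ≠ 0 → z ∈ Ω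

/-- The chords of `Ω_δ` from `a` to `b` avoiding a set `H` of lattice sites. -/
def Avoid {Ω : Set ℂ} {δ : ℝ} {a b : Site 2} (H : Set (Site 2)) : Set (SAW.DomainSAW Ω δ a b) :=
  {γ | ∀ v ∈ γ.walk.support, v ∉ H}

/-- **Excursion domination** (card `excursion-domination`; conjecture, discrete shadow of the
restriction exponents `5/8 ≤ 1`): there is ONE exponent `C` such that in every lattice domain of the
route's typing, for every finite set `H` of sites whose avoidance event is DOWN-closed in the
left–right order (a one-sided "right hull"), the critical chord avoids `H` with probability at least
the `C`-th power of the probability that the simple-random-walk excursion from `a` to `b` avoids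
`H`: `P_SAW(avoid H) ≥ (G_{Λ∖H}(a,b) / G_Λ(a,b))^C`, `Λ = Ω_δ`, `G` the Dirichlet Green function
(`dirichletGreen`, RW paths killed outside, weight `4^{-length}`), written cross-multiplied. By the
telescoping identity `P(avoid H₁ ∪ H₂) = P_Ω(avoid H₁) · P_{Ω∖H₁}(avoid H₂)` (exact for both measures)
it reduces to one-site sets `H = {y}`, `y` boundary-adjacent. -/
def ExcursionDomination : Prop :=
  ∃ Cexp : ℕ, ∀ (δ : ℝ) (c a b a' b' : Site 2) (C : (zdGraph 2).Walk c c), let Ω : Set ℂ := {z | Literature.Topology.PlaneTopology.wind (fun t : ℝ => Set.IccExtend zero_le_one (C.toCurve (meshPoint δ)) t - z) ≠ 0}; let le : SAW.DomainSAW Ω δ a b → SAW.DomainSAW Ω δ a b → Prop := fun γ₁ γ₂ => ∀ z : ℂ, 0 ≤ Literature.Topology.PlaneTopology.wind (fun t : ℝ => Set.IccExtend zero_le_one ((γ₁.walk.append γ₂.walk.reverse).toCurve (meshPoint δ)) t - z); 0 < δ → a' ∈ C.support → b' ∈ C.support → (zdGraph 2).Adj a a' → (zdGraph 2).Adj b b'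 → ∀ (H : Finset (Site 2)) (hΛ : (meshDomain Ω δ).Finite), (∀ γ₁ γ₂, le γ₁ γ₂ → γ₂ ∈ Avoid (H : Set (Site 2)) → γ₁ ∈ Avoid (H : Set (Site 2))) → SAW.weight Ω δ a b Set.univ * ENNReal.ofReal (dirichletGreen (hΛ.toFinset \ H) a b ^ Cexp) ≤ SAW.weight Ω δ a b (Avoid (H : Set (Site 2))) * ENNReal.ofReal (dirichletGreen hΛ.toFinset a b ^ Cexp)

end

end Summit.CriticalPhenomena.SAWScalingLimit.Cruxes.FKGToTraversalBound.Sketch
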